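import Literature.MathematicalPhysics.QuantumFieldTheory.BalabanImbrieJaffe1984to88.BIJ88Conditioning512

/-!
# `BalabanImbrieJaffe1984to88.BIJ88Measure5127` — T. Bałaban, J. Imbrie, A. Jaffe, *Effective action and cluster properties
of the abelian Higgs model*, Commun. Math. Phys. **114** (1988) 257–315 [BalabanImbrieJaffe1988], §5.12 *Conditional
Integration*, p. 302: the measure **(5.12.7)** `dμ^{(k)}_{Λ^{(k)}_{10}}(A^{(k)″}, φ^{(k)″})` — *"an uncentered, normalized Gaussian
measure … [with] covariances C^{(k)}_{Λ^{(k)c*c}_{10}}, C^{(k)}_{Λ^{(k)}_{10}}(u_{k+1}), and nonzero means reflecting the terms linear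
in Λ^{(k)}_{10}φ^{(k)″} or Λ^{(k)c*c}_{10}A^{(k)″}"* — PROVED, in Mathlib's sense (`ProbabilityTheory.multivariateGaussian`), on the
finite-dimensional Gaussian model the print describes

statement-level skeleton of published theorems with citation tags; proofs where landed; nothing here is a claim about the Yang–Mills mass gap

PDF held: `paper:balaban1988-cmp114-bij-abelian-higgs-effective-action` (journal page = PDF page + 256).  Render read this
session as an image: p. 302 = PDF 46 (`HOME/lit-balaban-p02/pages/original-p046-x2.png`).

CITATION HEADER (lean-in-tree rule).  Part of the lit-balaban TYPED SKELETON (HOME `run/shared/lean/pub/lit-balaban/`), row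
**C2.Eq5.12.1-5.12.7** (`HOME/lit-balaban-r16/ROWS-C2-part2.md`, fold owner r16), member *"the measure (5.12.7) proper"* (recorded
absent after p10's `BIJ88Conditioning512` — p. 300 identity, `normalized_eq_gaussProb` for ONE scalar sector — and p02 gen 4's
`BIJ88LocTransl5126` — the exponent of (5.12.7)).  Companion of p02 gen 6's `BIJ88ExteriorForms5121` ((5.12.1)–(5.12.3), (5.12.5)).
Built BY NAME on the tree's `B2Eq228Conditioning` (`integral_tilt`, `gaussProb`, `gaussProb_eq_map_multivariateGaussian`); nothing
restated.

**What the paper prints (p. 302 [PDF 46], verbatim).**  *"We make the same translation (5.12.4) in both numerator and denominator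
of the normalized integral in Λ^{(k)}_{10}. Terms quadratic in Λ^{(k)c*}_{10}A^{(k)} cancel, but we still have the linear forms
(5.12.5) and ⟨Λ^{(k)}_{10}φ^{(k)}, Δ_{k,loc}(u_{k+1})Λ^{(k)c}_{10}φ^{(k)}⟩ as in our last calculation. We remove most of these forms
with localized translations … (5.12.6) Terms quadratic in Λ^{(k)c*}_{10}A^{(k)} or Λ^{(k)c}_{10}φ^{(k)} cancel as before, leaving the
following integral: ∫dμ^{(k)}_{Λ^{(k)}_{10}}(A^{(k)″}, φ^{(k)″}) χ′_{Λ^{(k)}_7} Π_{σ₁∈σ̃₁} F^{m̄}_{k,loc}(X_{σ₁}) e^{−V^{(k)}(Λ^{(k)}_8,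
u_{k+1}, A^{(k)}, φ^{(k)})}.  Here dμ^{(k)}_{Λ^{(k)}_{10}} is an uncentered, normalized Gaussian measure,
  dμ^{(k)}_{Λ^{(k)}_{10}}(A^{(k)″}, φ^{(k)″}) = (1/𝒩) dA^{(k)″}|_{Λ^{(k)c*c}_{10}} dφ^{(k)″}|_{Λ^{(k)}_{10}} δ_{Ax,Λ^{(k)′}_{10}}(A^{(k)″})
    δ_{Λ^{(k)′c*c}_{10}}(QΛ^{(k)c*c}_{10}A^{(k)″})
  × exp[−½⟨Λ^{(k)c*c}_{10}A^{(k)″}, ∂*σ_{k,loc}∂Λ^{(k)c*c}_{10}A^{(k)″}⟩ − ½⟨Λ^{(k)}_{10}φ^{(k)}, (Δ_{k,loc}(u_{k+1}) + aL^{−2}P(u_{k+1}))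
    Λ^{(k)}_{10}φ^{(k)}⟩ − ⟨Λ^{(k)c*c}_{10}A^{(k)″}, (I − ∂*σ_{k,loc}∂C^{(k)}_{Λ^{(k)c*c}_{10},loc})∂*σ_{k,loc}∂(I − L^{−1}Λ^{(k)c*c}_{10}Q^{s*}Q)
    Λ^{(k)c*}_{10}A^{(k)}⟩ − ⟨Λ^{(k)}_{10}φ^{(k)″}, (I − (Δ_{k,loc}(u_{k+1}) + aL^{−2}P(u_{k+1}))C^{(k)}_{Λ^{(k)}_{10},loc}(u_{k+1}))Δ_{k,loc}(u_{k+1})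
    Λ^{(k)c}_{10}φ^{(k)}⟩].   (5.12.7)
This measure has covariances C^{(k)}_{Λ^{(k)c*c}_{10}}, C^{(k)}_{Λ^{(k)}_{10}}(u_{k+1}), and nonzero means reflecting the terms linear
in Λ^{(k)}_{10}φ^{(k)″} or Λ^{(k)c*c}_{10}A^{(k)″}."*

**The model (finite-dimensional, exactly the printed generality).**  As in `BIJ88ExteriorForms5121` §3, the `δ`-functions of
(5.12.7) are enforced by passing to free coordinates `x : ι → ℝ` of the constraint subspace of the interior gauge variables
(print, (4.8): *"the number of free integrations … after enforcing the δ-functions"*); the scalar interior field `Λ^{(k)}_{10}φ^{(k)″}`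
is `φ : κ → ℝ` (real coordinates).  DATA: the precisions `K : Matrix ι ι ℝ` (`∂*σ_{k,loc}∂` on the constraint subspace,
`= EᵀT_{in}E` of `BIJ88ExteriorForms5121.precK`) and `M : Matrix κ κ ℝ` (`(Δ_{k,loc}(u_{k+1}) + aL^{−2}P(u_{k+1}))_{Λ_{10}}`), both
positive definite; the two residual linear forms of (5.12.7) as source vectors `jA : ι → ℝ`, `jφ : κ → ℝ` (the exterior fields
are held fixed).  Then (5.12.7) reads `dμ(A″, φ″) = 𝒩⁻¹ dA″ dφ″ e^{−⟨jA,A″⟩−½⟨A″,KA″⟩} e^{−⟨jφ,φ″⟩−½⟨φ″,Mφ″⟩}`.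

**What is kernel-checked (zero `sorry`, standard axioms, no new named facts).**
 §1 `wA`, `wφ`, `calN` (= 𝒩), `expect` (= `∫dμ G` as the normalized functional), the means `meanA = −K⁻¹jA`, `meanφ = −M⁻¹jφ`.
 §2 `inner_shift`, `double_shift` (the two linear shifts, `integral_tilt`; NO hypothesis on `G`), `calN_eq` (𝒩 in closed form),
    `calN_pos`, **`expect_eq_gaussProb`**: `∫dμ G = ∫∫ G(z + meanA, w + meanφ) dν_M(w) dν_K(z)` with `ν` the normalized centred
    Gaussians of covariance `K⁻¹`, `M⁻¹` — *"uncentered, normalized Gaussian measure"* — and `expect_one` (*"normalized"*);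
    `ratio_cancel` = the sentence *"We make the same translation … in both numerator and denominator of the normalized integral
    … Terms quadratic in Λ^{c*}A cancel"*: a factor depending on the exterior field only drops out of `∫dμ`.
 §3 THE MEASURE: `mu` = the product of the two translated Gaussians as a `Measure ((ι → ℝ) × (κ → ℝ))`, a probability measure
    (`isProbabilityMeasure_mu`); **`expect_eq_integral_mu`** (for integrable `G`, Fubini): the functional (5.12.7) IS integration
    against `mu`; **`map_toLp_muA` / `map_toLp_muφ`**: each factor is Mathlib's `multivariateGaussian (mean) (K⁻¹)` resp.
    `multivariateGaussian (mean) (M⁻¹)`; hence **`integral_fst_apply_mu` / `integral_snd_apply_mu`** (*"nonzero means reflecting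
    the terms linear in …"*: `E[A″_b] = −(K⁻¹jA)_b`, `E[φ″_c] = −(M⁻¹jφ)_c`) and **`covariance_fst_apply_mu` /
    `covariance_snd_apply_mu`** (*"covariances C_{Λ^{c*c}}, C_{Λ_{10}}(u_{k+1})"*: `cov[A″_b, A″_{b′}] = (K⁻¹)_{bb′}`,
    `cov[φ″_c, φ″_{c′}] = (M⁻¹)_{cc′}`).
**Readings (declared).**  Real coordinates; `δ`-functions = free coordinates of the constraint subspace, so `C^{(k)}_{Λ^{c*c}_{10}}`
appears as `K⁻¹` in those coordinates (`= covK` of `BIJ88ExteriorForms5121` as an operator on configurations); constants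
`(e_k/2π)^{‖Λ‖}` absorbed in `𝒩`.  **Not claimed.**  The localized covariances `C_{loc}` and the random-walk bounds of p. 302,
(5.12.8), anything about `χ′`, `F^{m̄}_{k,loc}`, `V^{(k)}`; anything of B1–B16.  NOT summit progress; NOT continuum; NOT Clay.
Imports Literature only; no Summits import; modifies nothing.  Cell `lit-balaban` Phase 2, seat p02 gen 6.
-/

open MeasureTheory ProbabilityTheory Matrix Finset
open scoped BigOperators

namespace Literature.MathematicalPhysics.QuantumFieldTheory.BalabanImbrieJaffe1984to88.BIJ88Measure5127

open Balaban1983to89.B2Eq228Conditioning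
open Balaban1983to89.B13GaugeDevices (gaussWeight gaussInt gaussNorm gaussMean gaussInt_one_eq_gaussNorm)

noncomputable section

variable {ι κ : Type} [Fintype ι] [Fintype κ]
variable (K : Matrix ι ι ℝ) (M : Matrix κ κ ℝ) (jA : ι → ℝ) (jφ : κ → ℝ)

/-! ## §1 The density of (5.12.7) on the model -/

/-- The gauge factor of the density (5.12.7): `exp[−½⟨Λ^{c*c}A″, ∂*σ_{k,loc}∂Λ^{c*c}A″⟩ − ⟨Λ^{c*c}A″, (residual linear form)⟩]`
in the free coordinates `x` of the constraint subspace (`K` the precision, `jA` the source).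
[cite: BalabanImbrieJaffe1988, (5.12.7) p.302] -/
def wA (x : ι → ℝ) : ℝ := Real.exp (-(jA ⬝ᵥ x) - 1 / 2 * (x ⬝ᵥ (K *ᵥ x)))

/-- The scalar factor of the density (5.12.7): `exp[−½⟨Λ_{10}φ″, (Δ_{k,loc} + aL^{−2}P)Λ_{10}φ″⟩ − ⟨Λ_{10}φ″, (residual linear
form)⟩]`. [cite: BalabanImbrieJaffe1988, (5.12.7) p.302] -/
def wφ (φ : κ → ℝ) : ℝ := Real.exp (-(jφ ⬝ᵥ φ) - 1 / 2 * (φ ⬝ᵥ (M *ᵥ φ)))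

/-- **𝒩** of (5.12.7): the total mass `∫dA″∫dφ″ wA·wφ`. [cite: BalabanImbrieJaffe1988, (5.12.7) p.302] -/
def calN : ℝ := ∫ x : ι → ℝ, ∫ φ : κ → ℝ, wA K jA x * wφ M jφ φ

/-- **`∫dμ^{(k)}_{Λ_{10}}(A″, φ″) G(A″, φ″)`**: the normalized functional of (5.12.7) (print: `G = χ′_{Λ_7}ΠF^{m̄}_{k,loc}e^{−V^{(k)}}`).
[cite: BalabanImbrieJaffe1988, (5.12.7) p.302] -/
def expect (G : (ι → ℝ) → (κ → ℝ) → ℝ) : ℝ :=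
  (calN K M jA jφ)⁻¹ * ∫ x : ι → ℝ, ∫ φ : κ → ℝ, wA K jA x * wφ M jφ φ * G x φ

/-- The mean of the gauge sector: `−K⁻¹jA` (*"nonzero means reflecting the terms linear in Λ^{c*c}A″"*).
[cite: BalabanImbrieJaffe1988, (5.12.7) p.302] -/
def meanA [DecidableEq ι] : ι → ℝ := -(K⁻¹ *ᵥ jA)

/-- The mean of the scalar sector: `−M⁻¹jφ` (*"nonzero means reflecting the terms linear in Λ_{10}φ″"*).
[cite: BalabanImbrieJaffe1988, (5.12.7) p.302] -/
def meanφ [DecidableEq κ] : κ → ℝ := -(M⁻¹ *ᵥ jφ)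

omit [Fintype κ] in
/-- `z − K⁻¹jA = z + meanA`. [cite: BalabanImbrieJaffe1988, (5.12.7) p.302] -/
theorem sub_eq_add_meanA [DecidableEq ι] (z : ι → ℝ) : z - K⁻¹ *ᵥ jA = z + meanA K jA := by
  rw [meanA, sub_eq_add_neg]

omit [Fintype ι] in
/-- `w − M⁻¹jφ = w + meanφ`. [cite: BalabanImbrieJaffe1988, (5.12.7) p.302] -/
theorem sub_eq_add_meanφ [DecidableEq κ] (w : κ → ℝ) : w - M⁻¹ *ᵥ jφ = w + meanφ M jφ := by
  rw [meanφ, sub_eq_add_neg]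

/-- A real positive definite matrix is symmetric. [folklore] [cite: BalabanImbrieJaffe1988, (5.12.7) p.302] -/
private theorem isSymm_of_posDef {m : Type} [Fintype m] {A : Matrix m m ℝ} (hA : A.PosDef) : A.IsSymm := by
  have h := hA.isHermitian.eq
  rwa [conjTranspose_eq_transpose_of_trivial] at h

/-! ## §2 The two linear shifts: (5.12.7) is an uncentered, normalized Gaussian -/

/-- The inner (scalar) shift: `∫dφ″ wA(x)wφ(φ)G(x,φ) = wA(x)·e^{½⟨jφ,M⁻¹jφ⟩}∫dw e^{−½⟨w,Mw⟩}G(x, w − M⁻¹jφ)` — no hypothesis on `G`.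
[cite: BalabanImbrieJaffe1988, (5.12.7) p.302] -/
theorem inner_shift [DecidableEq κ] (hM : M.IsSymm) (hMdet : IsUnit M.det) (G : (ι → ℝ) → (κ → ℝ) → ℝ) (x : ι → ℝ) :
    ∫ φ : κ → ℝ, wA K jA x * wφ M jφ φ * G x φ
      = wA K jA x * (Real.exp (1 / 2 * (jφ ⬝ᵥ (M⁻¹ *ᵥ jφ))) * gaussInt M (fun w => G x (w - M⁻¹ *ᵥ jφ))) := by
  have h : ∀ φ, wA K jA x * wφ M jφ φ * G x φ = wA K jA x * (wφ M jφ φ * G x φ) := fun φ => mul_assoc _ _ _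
  simp_rw [h]
  rw [integral_const_mul]
  congr 1
  unfold wφ
  exact integral_tilt M hM hMdet jφ (fun φ => G x φ)

/-- Both shifts: `∫dA″∫dφ″ wA wφ G = e^{½⟨jA,K⁻¹jA⟩}e^{½⟨jφ,M⁻¹jφ⟩} ∫dz e^{−½⟨z,Kz⟩}∫dw e^{−½⟨w,Mw⟩} G(z − K⁻¹jA, w − M⁻¹jφ)` — no
hypothesis on `G`. [cite: BalabanImbrieJaffe1988, (5.12.7) p.302] -/
theorem double_shift [DecidableEq ι] [DecidableEq κ] (hK : K.IsSymm) (hKdet : IsUnit K.det) (hM : M.IsSymm)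
    (hMdet : IsUnit M.det) (G : (ι → ℝ) → (κ → ℝ) → ℝ) :
    ∫ x : ι → ℝ, ∫ φ : κ → ℝ, wA K jA x * wφ M jφ φ * G x φ
      = Real.exp (1 / 2 * (jA ⬝ᵥ (K⁻¹ *ᵥ jA))) * Real.exp (1 / 2 * (jφ ⬝ᵥ (M⁻¹ *ᵥ jφ)))
        * gaussInt K (fun z => gaussInt M (fun w => G (z - K⁻¹ *ᵥ jA) (w - M⁻¹ *ᵥ jφ))) := by
  simp_rw [inner_shift K M jA jφ hM hMdet G]
  have h2 : ∀ x : ι → ℝ, wA K jA x * (Real.exp (1 / 2 * (jφ ⬝ᵥ (M⁻¹ *ᵥ jφ)))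
      * gaussInt M (fun w => G x (w - M⁻¹ *ᵥ jφ)))
      = Real.exp (-(jA ⬝ᵥ x) - 1 / 2 * (x ⬝ᵥ (K *ᵥ x))) * gaussInt M (fun w => G x (w - M⁻¹ *ᵥ jφ))
        * Real.exp (1 / 2 * (jφ ⬝ᵥ (M⁻¹ *ᵥ jφ))) := by
    intro x
    unfold wA
    ring
  simp_rw [h2]
  rw [integral_mul_const, integral_tilt K hK hKdet jA (fun x => gaussInt M (fun w => G x (w - M⁻¹ *ᵥ jφ)))]
  ring

/-- **𝒩 in closed form**: `𝒩 = e^{½⟨jA,K⁻¹jA⟩}e^{½⟨jφ,M⁻¹jφ⟩} · ∫dz e^{−½⟨z,Kz⟩} · ∫dw e^{−½⟨w,Mw⟩}`.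
[cite: BalabanImbrieJaffe1988, (5.12.7) p.302] -/
theorem calN_eq [DecidableEq ι] [DecidableEq κ] (hK : K.IsSymm) (hKdet : IsUnit K.det) (hM : M.IsSymm)
    (hMdet : IsUnit M.det) :
    calN K M jA jφ
      = Real.exp (1 / 2 * (jA ⬝ᵥ (K⁻¹ *ᵥ jA))) * Real.exp (1 / 2 * (jφ ⬝ᵥ (M⁻¹ *ᵥ jφ)))
        * (gaussNorm K * gaussNorm M) := by
  unfold calN
  have h := double_shift K M jA jφ hK hKdet hM hMdet (fun _ _ => (1 : ℝ))
  simp only [mul_one] at h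
  rw [h, gaussInt_one_eq_gaussNorm]
  unfold gaussInt
  rw [integral_smul_const, smul_eq_mul]
  unfold gaussNorm
  ring

/-- `𝒩 > 0` (`K`, `M` positive definite). [cite: BalabanImbrieJaffe1988, (5.12.7) p.302] -/
theorem calN_pos [DecidableEq ι] [DecidableEq κ] (hK : K.PosDef) (hM : M.PosDef) : 0 < calN K M jA jφ := by
  rw [calN_eq K M jA jφ (isSymm_of_posDef hK) (isUnit_iff_ne_zero.2 hK.det_pos.ne') (isSymm_of_posDef hM)
    (isUnit_iff_ne_zero.2 hM.det_pos.ne')]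
  exact mul_pos (mul_pos (Real.exp_pos _) (Real.exp_pos _)) (mul_pos (gaussNorm_pos hK) (gaussNorm_pos hM))

/-- **(5.12.7) is an uncentered, normalized Gaussian measure** (p. 302): for EVERY `G`,
`∫dμ G = ∫dν_K(z) ∫dν_M(w) G(z − K⁻¹jA, w − M⁻¹jφ)`, `ν_K = gaussProb K` and `ν_M = gaussProb M` the normalized centred Gaussian
probability measures with covariances `K⁻¹` (`= C_{Λ^{c*c}}` in free coordinates) and `M⁻¹` (`= C_{Λ_{10}}(u_{k+1})`): the measure is
the product Gaussian translated by the means `−K⁻¹jA`, `−M⁻¹jφ`. [cite: BalabanImbrieJaffe1988, (5.12.7) p.302] -/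
theorem expect_eq_gaussProb [DecidableEq ι] [DecidableEq κ] (hK : K.PosDef) (hM : M.PosDef) (G : (ι → ℝ) → (κ → ℝ) → ℝ) :
    expect K M jA jφ G
      = ∫ z, (∫ w, G (z - K⁻¹ *ᵥ jA) (w - M⁻¹ *ᵥ jφ) ∂(gaussProb M)) ∂(gaussProb K) := by
  have hKs : K.IsSymm := isSymm_of_posDef hK
  have hMs : M.IsSymm := isSymm_of_posDef hM
  have hKdet : IsUnit K.det := isUnit_iff_ne_zero.2 hK.det_pos.ne'
  have hMdet : IsUnit M.det := isUnit_iff_ne_zero.2 hM.det_pos.ne'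
  have hgK : gaussNorm K ≠ 0 := (gaussNorm_pos hK).ne'
  have hgM : gaussNorm M ≠ 0 := (gaussNorm_pos hM).ne'
  have heA : Real.exp (1 / 2 * (jA ⬝ᵥ (K⁻¹ *ᵥ jA))) ≠ 0 := (Real.exp_pos _).ne'
  have heφ : Real.exp (1 / 2 * (jφ ⬝ᵥ (M⁻¹ *ᵥ jφ))) ≠ 0 := (Real.exp_pos _).ne'
  unfold expect
  rw [calN_eq K M jA jφ hKs hKdet hMs hMdet, double_shift K M jA jφ hKs hKdet hMs hMdet G, integral_gaussProb_eq]
  simp_rw [integral_gaussProb_eq M]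
  unfold gaussInt
  simp only [smul_eq_mul]
  have h3 : ∀ z : ι → ℝ, gaussWeight K z * ((gaussNorm M)⁻¹
      * ∫ w, gaussWeight M w * G (z - K⁻¹ *ᵥ jA) (w - M⁻¹ *ᵥ jφ))
      = (gaussNorm M)⁻¹ * (gaussWeight K z * ∫ w, gaussWeight M w * G (z - K⁻¹ *ᵥ jA) (w - M⁻¹ *ᵥ jφ)) := by
    intro z
    ring
  simp_rw [h3]
  rw [integral_const_mul]
  field_simp

/-- *"normalized"*: `∫dμ 1 = 1`. [cite: BalabanImbrieJaffe1988, (5.12.7) p.302] -/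
theorem expect_one [DecidableEq ι] [DecidableEq κ] (hK : K.PosDef) (hM : M.PosDef) :
    expect K M jA jφ (fun _ _ => 1) = 1 := by
  unfold expect
  simp_rw [mul_one]
  exact inv_mul_cancel₀ (calN_pos K M jA jφ hK hM).ne'

/-- **p. 302, verbatim: *"We make the same translation (5.12.4) in both numerator and denominator of the normalized integral in
Λ^{(k)}_{10}. Terms quadratic in Λ^{(k)c*}_{10}A^{(k)} cancel"*** — on the model: a factor `e^{q}` depending on the exterior field
only (the fourth form of `BIJ88ExteriorForms5121`) multiplies numerator and denominator alike and drops out of `∫dμ`.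
[cite: BalabanImbrieJaffe1988, (5.12.7) p.302] -/
theorem ratio_cancel (q : ℝ) (G : (ι → ℝ) → (κ → ℝ) → ℝ) :
    (∫ x : ι → ℝ, ∫ φ : κ → ℝ, Real.exp q * (wA K jA x * wφ M jφ φ))⁻¹
        * ∫ x : ι → ℝ, ∫ φ : κ → ℝ, Real.exp q * (wA K jA x * wφ M jφ φ) * G x φ
      = expect K M jA jφ G := by
  have hq : Real.exp q ≠ 0 := (Real.exp_pos q).ne'
  have h1 : ∀ x : ι → ℝ, (∫ φ : κ → ℝ, Real.exp q * (wA K jA x * wφ M jφ φ))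
      = Real.exp q * ∫ φ : κ → ℝ, wA K jA x * wφ M jφ φ := fun x => integral_const_mul _ _
  have h2 : ∀ x : ι → ℝ, (∫ φ : κ → ℝ, Real.exp q * (wA K jA x * wφ M jφ φ) * G x φ)
      = Real.exp q * ∫ φ : κ → ℝ, wA K jA x * wφ M jφ φ * G x φ := by
    intro x
    rw [← integral_const_mul]
    refine integral_congr_ae (Filter.Eventually.of_forall fun φ => ?_)
    ring
  simp_rw [h1, h2]
  rw [integral_const_mul, integral_const_mul, expect, calN, mul_inv, mul_mul_mul_comm, inv_mul_cancel₀ hq, one_mul]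

/-! ## §3 The measure, its means and its covariances -/

section Measure

variable [DecidableEq ι] [DecidableEq κ]

/-- The gauge factor of (5.12.7) as a probability measure on the free coordinates: the normalized centred Gaussian of covariance
`K⁻¹` translated by the mean `−K⁻¹jA`. [cite: BalabanImbrieJaffe1988, (5.12.7) p.302] -/
def muA : Measure (ι → ℝ) := (gaussProb K).map (fun z => z - K⁻¹ *ᵥ jA)

/-- The scalar factor of (5.12.7): the normalized centred Gaussian of covariance `M⁻¹` translated by `−M⁻¹jφ`.
[cite: BalabanImbrieJaffe1988, (5.12.7) p.302] -/
def muφ : Measure (κ → ℝ) := (gaussProb M).map (fun w => w - M⁻¹ *ᵥ jφ)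

/-- **(5.12.7) as a measure** `dμ^{(k)}_{Λ_{10}}(A″, φ″)` on (free gauge coordinates) × (scalar coordinates): the product of the two
translated Gaussians. [cite: BalabanImbrieJaffe1988, (5.12.7) p.302] -/
def mu : Measure ((ι → ℝ) × (κ → ℝ)) := (muA K jA).prod (muφ M jφ)

omit [Fintype κ] [DecidableEq κ] in
/-- `muA` is a probability measure. [cite: BalabanImbrieJaffe1988, (5.12.7) p.302] -/
theorem isProbabilityMeasure_muA (hK : K.PosDef) : IsProbabilityMeasure (muA K jA) := by
  haveI := isProbabilityMeasure_gaussProb hK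
  exact Measure.isProbabilityMeasure_map (measurable_sub_const _).aemeasurable

omit [Fintype ι] [DecidableEq ι] in
/-- `muφ` is a probability measure. [cite: BalabanImbrieJaffe1988, (5.12.7) p.302] -/
theorem isProbabilityMeasure_muφ (hM : M.PosDef) : IsProbabilityMeasure (muφ M jφ) := by
  haveI := isProbabilityMeasure_gaussProb hM
  exact Measure.isProbabilityMeasure_map (measurable_sub_const _).aemeasurable

/-- *"normalized"*: (5.12.7) is a probability measure. [cite: BalabanImbrieJaffe1988, (5.12.7) p.302] -/
theorem isProbabilityMeasure_mu (hK : K.PosDef) (hM : M.PosDef) : IsProbabilityMeasure (mu K M jA jφ) := by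
  haveI := isProbabilityMeasure_muA K jA hK
  haveI := isProbabilityMeasure_muφ M jφ hM
  unfold mu
  infer_instance

/-- **The functional (5.12.7) IS integration against `mu`**: for `G` measurable and `mu`-integrable,
`∫dμ G = ∫ G d(mu)` (the two linear shifts + Fubini). [cite: BalabanImbrieJaffe1988, (5.12.7) p.302] -/
theorem expect_eq_integral_mu (hK : K.PosDef) (hM : M.PosDef) (G : (ι → ℝ) → (κ → ℝ) → ℝ)
    (hGm : Measurable (Function.uncurry G)) (hGi : Integrable (Function.uncurry G) (mu K M jA jφ)) :
    expect K M jA jφ G = ∫ q, G q.1 q.2 ∂(mu K M jA jφ) := by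
  haveI := isProbabilityMeasure_muA K jA hK
  haveI := isProbabilityMeasure_muφ M jφ hM
  rw [expect_eq_gaussProb K M jA jφ hK hM G]
  have hF : (∫ q, G q.1 q.2 ∂(mu K M jA jφ)) = ∫ z, ∫ w, G z w ∂(muφ M jφ) ∂(muA K jA) := by
    unfold mu
    exact integral_prod (fun q : (ι → ℝ) × (κ → ℝ) => G q.1 q.2) hGi
  rw [hF, muA, integral_map (measurable_sub_const _).aemeasurable]
  · refine integral_congr_ae (Filter.Eventually.of_forall fun z => ?_)
    show (∫ w, G (z - K⁻¹ *ᵥ jA) (w - M⁻¹ *ᵥ jφ) ∂(gaussProb M)) = ∫ w, G (z - K⁻¹ *ᵥ jA) w ∂(muφ M jφ)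
    rw [muφ, integral_map (measurable_sub_const _).aemeasurable]
    exact (hGm.of_uncurry_left (x := z - K⁻¹ *ᵥ jA)).aestronglyMeasurable
  · exact (hGm.stronglyMeasurable.integral_prod_right (ν := muφ M jφ)).aestronglyMeasurable

/-- Translating Mathlib's centred multivariate Gaussian by `m` gives the multivariate Gaussian with mean `m`.
[folklore] [cite: BalabanImbrieJaffe1988, (5.12.7) p.302] -/
private theorem multivariateGaussian_map_const_add {n : Type} [Fintype n] [DecidableEq n] (m : EuclideanSpace ℝ n)
    (S : Matrix n n ℝ) :
    (multivariateGaussian 0 S).map (fun y => m + y) = multivariateGaussian m S := by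
  simp only [multivariateGaussian]
  rw [Measure.map_map (measurable_const_add m) (by fun_prop)]
  congr 1
  funext x
  simp

/-- A translated `gaussProb`, read on `EuclideanSpace`, is Mathlib's multivariate Gaussian with the translated mean and covariance
`A⁻¹`. [folklore] [cite: BalabanImbrieJaffe1988, (5.12.7) p.302] -/
private theorem map_toLp_gaussProb_sub {n : Type} [Fintype n] [DecidableEq n] {A : Matrix n n ℝ} (hA : A.PosDef)
    (c : n → ℝ) :
    ((gaussProb A).map (fun z => z - c)).map ⇑(MeasurableEquiv.toLp 2 (n → ℝ))
      = multivariateGaussian (WithLp.toLp 2 (-c)) A⁻¹ := by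
  set e := MeasurableEquiv.toLp 2 (n → ℝ) with he
  rw [gaussProb_eq_map_multivariateGaussian hA, Measure.map_map (measurable_sub_const c) e.symm.measurable,
    Measure.map_map e.measurable ((measurable_sub_const c).comp e.symm.measurable)]
  have hcomp : (⇑e ∘ ((fun z : n → ℝ => z - c) ∘ ⇑e.symm))
      = fun y : EuclideanSpace ℝ n => WithLp.toLp 2 (-c) + y := by
    funext y
    simp only [Function.comp_apply, he, MeasurableEquiv.toLp_symm_apply, MeasurableEquiv.toLp_apply]
    rw [← WithLp.toLp_add, sub_eq_add_neg, add_comm]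
  rw [hcomp, multivariateGaussian_map_const_add]

omit [Fintype κ] [DecidableEq κ] in
/-- **The gauge factor is Mathlib's `multivariateGaussian (−K⁻¹jA) K⁻¹`** (read on `EuclideanSpace ℝ ι`): mean `−K⁻¹jA`, covariance
matrix `K⁻¹ = C_{Λ^{c*c}}` (free coordinates). [cite: BalabanImbrieJaffe1988, (5.12.7) p.302] -/
theorem map_toLp_muA (hK : K.PosDef) :
    (muA K jA).map ⇑(MeasurableEquiv.toLp 2 (ι → ℝ)) = multivariateGaussian (WithLp.toLp 2 (meanA K jA)) K⁻¹ := by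
  rw [muA, meanA]
  exact map_toLp_gaussProb_sub hK _

omit [Fintype ι] [DecidableEq ι] in
/-- **The scalar factor is Mathlib's `multivariateGaussian (−M⁻¹jφ) M⁻¹`**: mean `−M⁻¹jφ`, covariance matrix
`M⁻¹ = C_{Λ_{10}}(u_{k+1})`. [cite: BalabanImbrieJaffe1988, (5.12.7) p.302] -/
theorem map_toLp_muφ (hM : M.PosDef) :
    (muφ M jφ).map ⇑(MeasurableEquiv.toLp 2 (κ → ℝ)) = multivariateGaussian (WithLp.toLp 2 (meanφ M jφ)) M⁻¹ := by
  rw [muφ, meanφ]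
  exact map_toLp_gaussProb_sub hM _

/-- Mean of a coordinate under a translated `gaussProb`. [folklore] [cite: BalabanImbrieJaffe1988, (5.12.7) p.302] -/
private theorem integral_apply_of_map_toLp {n : Type} [Fintype n] [DecidableEq n] {ν : Measure (n → ℝ)}
    {m : n → ℝ} {S : Matrix n n ℝ} (hS : S.PosSemidef)
    (hν : ν.map ⇑(MeasurableEquiv.toLp 2 (n → ℝ)) = multivariateGaussian (WithLp.toLp 2 m) S) (b : n) :
    ∫ x, x b ∂ν = m b := by
  set e := MeasurableEquiv.toLp 2 (n → ℝ) with he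
  have hX : Measurable (fun y : EuclideanSpace ℝ n => y b) := by fun_prop
  have h1 : ∫ x, x b ∂ν = ∫ y, (fun y : EuclideanSpace ℝ n => y b) y ∂(ν.map ⇑e) := by
    rw [integral_map e.measurable.aemeasurable hX.aestronglyMeasurable]
    rfl
  rw [h1, hν]
  have h2 := (measurePreserving_eval_multivariateGaussian (μ := WithLp.toLp 2 m) hS (i := b)).map_eq
  have h3 : ∫ t, t ∂((multivariateGaussian (WithLp.toLp 2 m) S).map (fun y : EuclideanSpace ℝ n => y b))
      = ∫ y, (fun y : EuclideanSpace ℝ n => y b) y ∂(multivariateGaussian (WithLp.toLp 2 m) S) :=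
    integral_map (φ := fun y : EuclideanSpace ℝ n => y b) (f := fun t : ℝ => t) hX.aemeasurable
      aestronglyMeasurable_id
  rw [← h3, h2, integral_id_gaussianReal]

/-- Covariance of two coordinates under a translated `gaussProb`. [folklore] [cite: BalabanImbrieJaffe1988, (5.12.7) p.302] -/
private theorem covariance_apply_of_map_toLp {n : Type} [Fintype n] [DecidableEq n] {ν : Measure (n → ℝ)}
    {m : n → ℝ} {S : Matrix n n ℝ} (hS : S.PosSemidef)
    (hν : ν.map ⇑(MeasurableEquiv.toLp 2 (n → ℝ)) = multivariateGaussian (WithLp.toLp 2 m) S) (b b' : n) :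
    cov[fun x => x b, fun x => x b'; ν] = S b b' := by
  set e := MeasurableEquiv.toLp 2 (n → ℝ) with he
  have hXa : Measurable (fun y : EuclideanSpace ℝ n => y b) := by fun_prop
  have hXb : Measurable (fun y : EuclideanSpace ℝ n => y b') := by fun_prop
  have h := covariance_map (μ := ν) hXa.aestronglyMeasurable hXb.aestronglyMeasurable e.measurable.aemeasurable
  rw [hν, covariance_eval_multivariateGaussian hS] at h
  rw [h]
  rfl

/-- **"nonzero means reflecting the terms linear in Λ^{c*c}A″"**: `E_μ[A″_b] = −(K⁻¹jA)_b`.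
[cite: BalabanImbrieJaffe1988, (5.12.7) p.302] -/
theorem integral_fst_apply_mu (hK : K.PosDef) (hM : M.PosDef) (b : ι) :
    ∫ q, q.1 b ∂(mu K M jA jφ) = meanA K jA b := by
  haveI := isProbabilityMeasure_muA K jA hK
  haveI := isProbabilityMeasure_muφ M jφ hM
  have h1 : (mu K M jA jφ).map Prod.fst = muA K jA := by
    rw [mu, Measure.map_fst_prod, measure_univ, one_smul]
  have hX : Measurable (fun z : ι → ℝ => z b) := measurable_pi_apply b
  have h2 : ∫ q, q.1 b ∂(mu K M jA jφ) = ∫ z, z b ∂((mu K M jA jφ).map Prod.fst) := by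
    rw [integral_map measurable_fst.aemeasurable hX.aestronglyMeasurable]
  rw [h2, h1]
  exact integral_apply_of_map_toLp hK.inv.posSemidef (map_toLp_muA K jA hK) b

/-- **"nonzero means reflecting the terms linear in Λ_{10}φ″"**: `E_μ[φ″_c] = −(M⁻¹jφ)_c`.
[cite: BalabanImbrieJaffe1988, (5.12.7) p.302] -/
theorem integral_snd_apply_mu (hK : K.PosDef) (hM : M.PosDef) (c : κ) :
    ∫ q, q.2 c ∂(mu K M jA jφ) = meanφ M jφ c := by
  haveI := isProbabilityMeasure_muA K jA hK
  haveI := isProbabilityMeasure_muφ M jφ hM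
  have h1 : (mu K M jA jφ).map Prod.snd = muφ M jφ := by
    rw [mu, Measure.map_snd_prod, measure_univ, one_smul]
  have hX : Measurable (fun w : κ → ℝ => w c) := measurable_pi_apply c
  have h2 : ∫ q, q.2 c ∂(mu K M jA jφ) = ∫ w, w c ∂((mu K M jA jφ).map Prod.snd) := by
    rw [integral_map measurable_snd.aemeasurable hX.aestronglyMeasurable]
  rw [h2, h1]
  exact integral_apply_of_map_toLp hM.inv.posSemidef (map_toLp_muφ M jφ hM) c

/-- **"This measure has covariances C^{(k)}_{Λ^{(k)c*c}_{10}}"** (free coordinates: `K⁻¹`): `cov_μ[A″_b, A″_{b′}] = (K⁻¹)_{bb′}`.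
[cite: BalabanImbrieJaffe1988, (5.12.7) p.302] -/
theorem covariance_fst_apply_mu (hK : K.PosDef) (hM : M.PosDef) (b b' : ι) :
    cov[fun q => q.1 b, fun q => q.1 b'; mu K M jA jφ] = K⁻¹ b b' := by
  haveI := isProbabilityMeasure_muA K jA hK
  haveI := isProbabilityMeasure_muφ M jφ hM
  have h1 : (mu K M jA jφ).map Prod.fst = muA K jA := by
    rw [mu, Measure.map_fst_prod, measure_univ, one_smul]
  have hXa : Measurable (fun z : ι → ℝ => z b) := measurable_pi_apply b
  have hXb : Measurable (fun z : ι → ℝ => z b') := measurable_pi_apply b'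
  have h := covariance_map (μ := mu K M jA jφ) hXa.aestronglyMeasurable hXb.aestronglyMeasurable
    measurable_fst.aemeasurable
  rw [h1, covariance_apply_of_map_toLp hK.inv.posSemidef (map_toLp_muA K jA hK)] at h
  have e1 : (fun q : (ι → ℝ) × (κ → ℝ) => q.1 b) = (fun z : ι → ℝ => z b) ∘ Prod.fst := rfl
  have e2 : (fun q : (ι → ℝ) × (κ → ℝ) => q.1 b') = (fun z : ι → ℝ => z b') ∘ Prod.fst := rfl
  rw [e1, e2]
  exact h.symm

/-- **"… C^{(k)}_{Λ^{(k)}_{10}}(u_{k+1})"** (`M⁻¹`): `cov_μ[φ″_c, φ″_{c′}] = (M⁻¹)_{cc′}`. [cite: BalabanImbrieJaffe1988, (5.12.7) p.302] -/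
theorem covariance_snd_apply_mu (hK : K.PosDef) (hM : M.PosDef) (c c' : κ) :
    cov[fun q => q.2 c, fun q => q.2 c'; mu K M jA jφ] = M⁻¹ c c' := by
  haveI := isProbabilityMeasure_muA K jA hK
  haveI := isProbabilityMeasure_muφ M jφ hM
  have h1 : (mu K M jA jφ).map Prod.snd = muφ M jφ := by
    rw [mu, Measure.map_snd_prod, measure_univ, one_smul]
  have hXa : Measurable (fun w : κ → ℝ => w c) := measurable_pi_apply c
  have hXb : Measurable (fun w : κ → ℝ => w c') := measurable_pi_apply c'
  have h := covariance_map (μ := mu K M jA jφ) hXa.aestronglyMeasurable hXb.aestronglyMeasurable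
    measurable_snd.aemeasurable
  rw [h1, covariance_apply_of_map_toLp hM.inv.posSemidef (map_toLp_muφ M jφ hM)] at h
  have e1 : (fun q : (ι → ℝ) × (κ → ℝ) => q.2 c) = (fun w : κ → ℝ => w c) ∘ Prod.snd := rfl
  have e2 : (fun q : (ι → ℝ) × (κ → ℝ) => q.2 c') = (fun w : κ → ℝ => w c') ∘ Prod.snd := rfl
  rw [e1, e2]
  exact h.symm

end Measure

end

end Literature.MathematicalPhysics.QuantumFieldTheory.BalabanImbrieJaffe1984to88.BIJ88Measure5127
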